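import Mathlib
import Summits.ResolutionOfSingularities.ResolutionOfSingularities.Theorems.SyzygyFlatteningDefs
import Summits.ResolutionOfSingularities.ResolutionOfSingularities.Theorems.SyzygyFlatteningHigherRankTerminationEssFiniteType
import Summits.ResolutionOfSingularities.ResolutionOfSingularities.Theorems.SyzygyFlatteningHigherRankTerminationBaseChangeIsLocalization
import HarnessLib

/-!
# Normalisation commutes with the base change `C ↦ k(X)·C` (`stub_nrm_baseChange`)

Crux `HigherRankTermination` (stmt-ResolutionOfSingularities-17045), line `birth`, base-change line
of `stub_posDimRankOne`, registered stub `stub_nrm_baseChange` (held by the lead).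

For a model `C ⊆ K` with `Frac C = K` and its base change `E = k(X)·C ⊆ K(X)` (a localisation of
`C[X]` at the non-zero `k`-polynomials, `stub_baseChange_isLocalization`, fed as a hypothesis):
`nrm E = k(X)·(nrm C)`, where `nrm` is the integral closure inside the ambient field
(`Theorems/SyzygyFlatteningDefs.lean`).

* `⊇`: an element of `K` integral over `C` is integral over `E ⊇ C` in `K(X)`
  (`IsIntegral.map_of_comp_eq`).
* `⊆`: if `y ∈ K(X)` is integral over `E = M⁻¹ C[X]`, some `m y`, `m ∈ M`, is integral over `C[X]`
  (Mathlib `IsIntegral.exists_multiple_integral_of_isLocalization`); being integral over `K[X]`,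
  which is integrally closed in its fraction field `K(X)`, `m y` is a polynomial `g ∈ K[X]`
  (`IsIntegrallyClosed.isIntegral_iff`), and a polynomial integral over `C[X]` has coefficients
  integral over `C` (Mathlib `Polynomial.isIntegral_iff_isIntegral_coeff`, Stacks 030A); so
  `m y ∈ (nrm C)[X] ⊆ k(X)·(nrm C)`, and `m` is a unit of `k(X)`.

References: Matsumura, *Commutative Ring Theory*, §9 (integral closure and localisation);
The Stacks Project, Tag 030A.
-/

noncomputable section

-- single-problem summit: the doubled namespace component `ResolutionOfSingularities` is forced
set_option linter.dupNamespace false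

namespace Summit.ResolutionOfSingularities.ResolutionOfSingularities.Theorems.SyzygyFlattening

open Polynomial

/-- A polynomial over `K` whose coefficients lie in a `k`-subalgebra `D ⊆ K`, read in `K(X)`, lies in
the `k'`-subalgebra of `K(X)` generated by the image of `D`, as soon as `X` does. [folklore] -/
theorem algebraMap_polynomial_mem_adjoin {k K k' : Type*} [Field k] [Field K] [Algebra k K]
    [Field k'] [Algebra k' (RatFunc K)] (D : Subalgebra k K) (T : Subalgebra k' (RatFunc K))
    (hD : ∀ d ∈ D, algebraMap K (RatFunc K) d ∈ T) (hX : (RatFunc.X : RatFunc K) ∈ T)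
    (g : Polynomial K) (hg : ∀ n, g.coeff n ∈ D) :
    algebraMap (Polynomial K) (RatFunc K) g ∈ T := by
  rw [← RatFunc.aeval_X_left_eq_algebraMap, Polynomial.aeval_eq_sum_range]
  refine Subalgebra.sum_mem _ fun n _ => ?_
  rw [Algebra.smul_def]
  exact Subalgebra.mul_mem _ (hD _ (hg n)) (Subalgebra.pow_mem _ hX n)

/-- The action of a submonoid element through an algebra structure is multiplication by its image
(stated abstractly, so that no instance on `RatFunc K` has to be synthesised when it is used).
[folklore] -/
theorem submonoid_smul_eq_algebraMap_mul {R S : Type*} [CommRing R] [CommRing S] [Algebra R S]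
    (M : Submonoid R) (m : M) (y : S) : m • y = algebraMap R S m * y := by
  rw [Submonoid.smul_def, Algebra.smul_def]

/-- **STUB `stub_nrm_baseChange` (normalisation commutes with the base change `C ↦ k(X)·C`).**
For a model `C ⊆ K` with `Frac C = K` and `E = k(X)·C ⊆ K(X)` a localisation of `C[X]` at the
non-zero `k`-polynomials: `nrm E = k(X)·(nrm C)`. `⊇`: integrality is preserved along
`C → E`. `⊆`: for `y` integral over `E`, some `m • y` (`m ∈ M`) is integral over `C[X]`
(`IsIntegral.exists_multiple_integral_of_isLocalization`), hence a polynomial `g ∈ K[X]` (`K[X]` is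
integrally closed in `K(X)`) with coefficients integral over `C`
(`Polynomial.isIntegral_iff_isIntegral_coeff`), i.e. `m • y ∈ (nrm C)[X] ⊆ k(X)·(nrm C)`; and `m` is
a unit of `k(X)`. [cite: Matsumura1987, §9 (Example 9.1)] -/
theorem stub_nrm_baseChange : ∀ (k K : Type) [Field k] [Field K] [Algebra k K],
    ∀ (k' : Type) [Field k'] [Algebra k k'] [Algebra k' (RatFunc K)] [IsScalarTower k k' (RatFunc K)],
      Set.range (algebraMap k' (RatFunc K)) =
        ((IntermediateField.adjoin k {(RatFunc.X : RatFunc K)} : IntermediateField k (RatFunc K)) :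
          Set (RatFunc K)) →
    ∀ (C : Subalgebra k K) (E : Subalgebra k' (RatFunc K)),
      E = Algebra.adjoin k' ((algebraMap K (RatFunc K)) '' (C : Set K)) → IsFractionRing ↥C K →
    ∀ (ψ : ↥C →+* ↥E) (XE : ↥E),
      (∀ b : ↥C, (ψ b : RatFunc K) = algebraMap K (RatFunc K) b) → (XE : RatFunc K) = RatFunc.X →
      @IsLocalization (Polynomial ↥C) _
        ((nonZeroDivisors (Polynomial k)).map (Polynomial.mapRingHom (algebraMap k ↥C)))
        ↥E _ (Polynomial.eval₂RingHom ψ XE).toAlgebra →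
      nrm E = Algebra.adjoin k' ((algebraMap K (RatFunc K)) '' (nrm C : Set K)) := by
  intro k K _ _ _ k' _ _ _ _ hrange C E _ _ ψ XE hψ hXE hloc
  -- `X ∈ k' ⊆ E` and every non-zero `k`-polynomial in `X` is a unit of `k'`
  have hXk' : (RatFunc.X : RatFunc K) ∈ Set.range (algebraMap k' (RatFunc K)) := by
    rw [hrange]
    exact IntermediateField.mem_adjoin_simple_self k (RatFunc.X : RatFunc K)
  -- the algebra structures `C[X] → E → K(X)`
  letI iCE : Algebra (Polynomial ↥C) ↥E := (Polynomial.eval₂RingHom ψ XE).toAlgebra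
  haveI : IsLocalization ((nonZeroDivisors (Polynomial k)).map
      (Polynomial.mapRingHom (algebraMap k ↥C))) ↥E := hloc
  letI iCF : Algebra (Polynomial ↥C) (RatFunc K) :=
    ((algebraMap ↥E (RatFunc K)).comp (algebraMap (Polynomial ↥C) ↥E)).toAlgebra
  -- (never spell out `SMul (Polynomial C) (RatFunc K)`: typeclass search on `RatFunc K` is slow;
  -- the scalar-tower facts are obtained from `of_algebraMap_eq` without restating their type)
  have hST₁ := IsScalarTower.of_algebraMap_eq (R := Polynomial ↥C) (S := ↥E) (A := RatFunc K)
    fun _ => rfl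
  have halgCF : ∀ f : Polynomial ↥C, algebraMap (Polynomial ↥C) (RatFunc K) f =
      algebraMap (Polynomial K) (RatFunc K) (f.map (algebraMap ↥C K)) := fun f =>
    baseChangeIsLocalization_coe_eval₂RingHom C E ψ XE hψ hXE f
  apply le_antisymm
  · -- `⊆`
    intro y hy
    have hyint : IsIntegral ↥E y := (mem_nrm_iff E).mp hy
    obtain ⟨⟨m, hm⟩, hmy⟩ :=
      IsIntegral.exists_multiple_integral_of_isLocalization
        ((nonZeroDivisors (Polynomial k)).map (Polynomial.mapRingHom (algebraMap k ↥C))) y hyint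
    -- `m • y` read through `C[X] → K[X] → K(X)`
    letI iCK : Algebra (Polynomial ↥C) (Polynomial K) := Polynomial.algebra ↥C K
    have hST₂ := IsScalarTower.of_algebraMap_eq (R := Polynomial ↥C) (S := Polynomial K)
      (A := RatFunc K) fun f => halgCF f
    have hint' := hmy.tower_top (A := Polynomial K)
    obtain ⟨g, hg⟩ := (IsIntegrallyClosed.isIntegral_iff (R := Polynomial K) (K := RatFunc K)).mp hint'
    -- `g` is integral over `C[X]`, so its coefficients are integral over `C`
    have hgint : IsIntegral (Polynomial ↥C) g := by
      have h := (isIntegral_algHom_iff (IsScalarTower.toAlgHom (Polynomial ↥C) (Polynomial K)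
        (RatFunc K)) (IsFractionRing.injective (Polynomial K) (RatFunc K)) (x := g)).mp
      apply h
      change IsIntegral (Polynomial ↥C) (algebraMap (Polynomial K) (RatFunc K) g)
      rw [hg]
      exact hmy
    have hcoeff : ∀ n, g.coeff n ∈ nrm C := fun n =>
      (mem_nrm_iff C).mpr (Polynomial.isIntegral_iff_isIntegral_coeff.mp hgint n)
    -- hence `m • y ∈ k(X)·(nrm C)`
    obtain ⟨x', hx'⟩ := hXk'
    have hXT : (RatFunc.X : RatFunc K) ∈
        Algebra.adjoin k' ((algebraMap K (RatFunc K)) '' (nrm C : Set K)) := by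
      rw [← hx']
      exact Subalgebra.algebraMap_mem _ x'
    have hmy_mem : algebraMap (Polynomial K) (RatFunc K) g ∈
        Algebra.adjoin k' ((algebraMap K (RatFunc K)) '' (nrm C : Set K)) :=
      algebraMap_polynomial_mem_adjoin (nrm C)
        (Algebra.adjoin k' ((algebraMap K (RatFunc K)) '' (nrm C : Set K)))
        (fun d hd => Algebra.subset_adjoin ⟨d, hd, rfl⟩) hXT g hcoeff
    -- and `m` is (the image of) a non-zero element of `k'`
    obtain ⟨G, hG, rfl⟩ := Submonoid.mem_map.mp hm
    have hG0 : G ≠ 0 := nonZeroDivisors.ne_zero hG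
    have hmval : algebraMap (Polynomial ↥C) (RatFunc K) (Polynomial.mapRingHom (algebraMap k ↥C) G) =
        Polynomial.aeval (RatFunc.X : RatFunc K) G :=
      baseChangeIsLocalization_coe_eval₂RingHom_map C E ψ XE hψ hXE G
    have hmk' : Polynomial.aeval (RatFunc.X : RatFunc K) G ∈ Set.range (algebraMap k' (RatFunc K)) := by
      refine ⟨Polynomial.aeval x' G, ?_⟩
      rw [← hx', Polynomial.aeval_algebraMap_apply]
    obtain ⟨g', hg'⟩ := hmk'
    have hg'0 : g' ≠ 0 := by
      rintro rfl
      rw [map_zero] at hg'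
      exact baseChangeIsLocalization_aeval_X_ne_zero (K := K) hG0 hg'.symm
    -- (the `•` below is the one of the lemma's statement; we never write a fresh `• y` ourselves)
    have hsmul : algebraMap (Polynomial K) (RatFunc K) g = algebraMap k' (RatFunc K) g' * y := by
      rw [hg, submonoid_smul_eq_algebraMap_mul]
      change algebraMap (Polynomial ↥C) (RatFunc K) (Polynomial.mapRingHom (algebraMap k ↥C) G) * y = _
      rw [hmval, hg']
    have hy_eq : y = algebraMap k' (RatFunc K) g'⁻¹ * algebraMap (Polynomial K) (RatFunc K) g := by
      rw [hsmul, ← mul_assoc, ← map_mul, inv_mul_cancel₀ hg'0, map_one, one_mul]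
    rw [hy_eq]
    exact Subalgebra.mul_mem _ (Subalgebra.algebraMap_mem _ _) hmy_mem
  · -- `⊇`
    refine Algebra.adjoin_le ?_
    rintro _ ⟨z, hz, rfl⟩
    have hzint : IsIntegral ↥C z := (mem_nrm_iff C).mp hz
    refine (mem_nrm_iff E).mpr ?_
    refine hzint.map_of_comp_eq ψ (algebraMap K (RatFunc K)) ?_
    refine RingHom.ext fun c => ?_
    change ((ψ c : ↥E) : RatFunc K) = algebraMap K (RatFunc K) (c : K)
    exact hψ c

end Summit.ResolutionOfSingularities.ResolutionOfSingularities.Theorems.SyzygyFlattening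

end
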